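import Mathlib
import HarnessLib
import Literature.AlgebraicGeometry.HyperbolicPolynomials.SpectrahedralShadow
import Summits.ValiantsHypothesis.ValiantsHypothesis.Theorems.PermanentalConesHyperbolicVPShadowSymmetricCase

/-!
# ValiantsHypothesis / PermanentalCones — `HyperbolicVPShadow`, stub S

Route `PermanentalCones`, item `stmt-ValiantsHypothesis-8655` (crux `HyperbolicVPShadow`), line
`birth`, stub `stub_spectrahedron_of_symmDetIdentity` (a symmetric determinantal identity makes the
nonnegative-spectrum cone a size-`N` spectrahedron).

If `P` and `L` are linear pencils of real `N × N` matrices, every `L x` is symmetric, and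
`det (P x + τ·1) = det (L x + τ·1)` for all `x, τ`, then the closed "nonnegative spectrum" cone
`{x : ∀ τ > 0, det (P x + τ·1) ≠ 0}` of `P` coincides with that of `L` (rewrite with the
identity), and the latter is the spectrahedron `{x : L x ⪰ 0}`
(`permanentalCones_forall_det_add_smul_one_ne_zero_iff`), a lifted-LMI set of size `N` with no
lifting variables (`permanentalCones_realSpectrumShadow_symmetric`: `p = 0`, `A (x, y) = L x`,
`B = 0`).
-/

-- `<Problem> = <Summit>` for this single-conjunct summit (lakefile sets the same option tree-wide).
set_option linter.dupNamespace false

namespace Summit.ValiantsHypothesis.ValiantsHypothesis.Theorems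

open Matrix

/-- **Stub S (symmetric determinantal identity ⇒ spectrahedron).** If `L` is a linear pencil of
real symmetric `N × N` matrices and `det (P x + τ·1) = det (L x + τ·1)` for all `x, τ`, then the
closed nonnegative-spectrum cone `{x : ∀ τ > 0, det (P x + τ·1) ≠ 0}` of `P` is the spectrahedron
`{x : L x ⪰ 0}`, a lifted-LMI set of size `N` (no lifting variables). [folklore] -/
theorem stub_spectrahedron_of_symmDetIdentity :
    ∀ (n N : ℕ) (P L : (Fin n → ℝ) →ₗ[ℝ] Matrix (Fin N) (Fin N) ℝ),
      (∀ x : Fin n → ℝ, (L x).IsSymm) →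
      (∀ (x : Fin n → ℝ) (τ : ℝ), (P x + τ • (1 : Matrix (Fin N) (Fin N) ℝ)).det =
        (L x + τ • (1 : Matrix (Fin N) (Fin N) ℝ)).det) →
      Literature.AlgebraicGeometry.HyperbolicPolynomials.IsSpectrahedralShadowOfSize
        {x : Fin n → ℝ | ∀ τ : ℝ, 0 < τ → (P x + τ • (1 : Matrix (Fin N) (Fin N) ℝ)).det ≠ 0} N := by
  intro n N P L hL hPL
  obtain ⟨p, A, B, h⟩ := permanentalCones_realSpectrumShadow_symmetric n N L hL
  refine ⟨p, A, B, fun x => ?_⟩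
  rw [← h x, Set.mem_setOf_eq]
  simp only [hPL]

end Summit.ValiantsHypothesis.ValiantsHypothesis.Theorems
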